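import Mathlib
import Summits.ValiantsHypothesis.ValiantsHypothesis.Theorems.ProofCarryingSymmetryRestorationQPUnitNorm
import Summits.ValiantsHypothesis.ValiantsHypothesis.Theorems.ProofCarryingSymmetryRestorationQPACConverse

/-!
# Route ProofCarryingSymmetry — crux `RestorationQP`, line `registered`, rung S3‴ under stub S2″ (`stub_proofsToACEquiv`), part 3:
stability when invariance proofs avoid only distributivity and the constant equations

Continuation of `…RestorationQPUnitEq.lean` / `…RestorationQPUnitNorm.lean` (`UEq`, `unorm`).  First the
remaining bookkeeping of the normaliser: every subformula of `unorm F` is the normal form of a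
subformula of `F` (`subs_unorm_subset`), and `unorm` preserves the computed polynomial
(`eval_unorm`).  Then, for a Hrubeš–Tzameret circuit `C`, let `unitClass C := ⟦unorm C•⟧` be the
AC-class of the unit normal form of its unfolding.
If for every `σ ∈ S_n` the unfoldings `(C ∘ σ)•` and `C•` are inter-derivable in `P_f(ℂ)` WITHOUT A6
(distributivity) and A10 (constant equations) — the unit laws A7–A9 being allowed — then
`UEq (C ∘ σ)• C•` (ACU-soundness, part 1), so `ACEq (unorm (C ∘ σ)•) (unorm C•)` (the key lemma of
part 2) and, since `unorm` commutes with renaming, `σ • unitClass C = unitClass C`.  The S3″ pipeline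
(`…ACReach`, `…ACUnfoldSize`, `…ACCircuit`, `…ACCircuitEval`) applied to the class `unitClass C` —
at most `|C| + 1` reachable classes (subformula control of `unorm`), multiplicities `< 2^(|C|+1)`
(`unorm` does not increase sizes) — gives the AC-canonical circuit of `unitClass C`: an
`S_n`-symmetric Dawar–Wilsenach circuit computing `Ĉ` of size `≤ (|C| + n + 2)^4`.

* `stabilityAtUnitEquiv` — rung S3‴ in the `P_f`-phrasing (budget `0` on A6, A10 only);
* `stabilityAtUnitBudget` — the same from `P_c` proofs of the presentations `C ∘ σ = C`;
* `proofsToACEquiv_of_proofsToUnitEquiv` — the correspondingly WEAKENED bet S2‴ (invariance proofs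
  ⇒ a poly-larger circuit whose renamed unfoldings are inter-derivable with its unfolding without
  A6/A10) still implies the registered bet S2″ `stub_proofsToACEquiv` (via `stabilityAtUnitEquiv` and
  the layout `ACStability.exists_piCircuit_of_isSymmetric` of `…ACConverse.lean`), so the line's bet
  becomes pure distributivity-and-constant elimination.

Everything proved; no named facts.
-/

-- single-problem summit: `Summit.ValiantsHypothesis.ValiantsHypothesis.…` is the namespace by design (D-0017)
set_option linter.dupNamespace false

noncomputable section

open scoped Classical

namespace Summit.ValiantsHypothesis.ValiantsHypothesis.Theorems

namespace ACStability

open Literature.Computability.AlgebraicComplexity ACClass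

universe u v

variable {𝔽 : Type u} {X : Type v}

/-! ### Subformulas of the unit normal form (the gate budget) -/

/-- Subformulas of the left summand are subformulas. [folklore] -/
theorem mem_subs_add_left {F G K : PIFormula 𝔽 X} (h : K ∈ subs F) : K ∈ subs (.add F G) := by
  simp only [subs, List.mem_cons, List.mem_append]
  exact Or.inr (Or.inl h)

/-- Subformulas of the right summand are subformulas. [folklore] -/
theorem mem_subs_add_right {F G K : PIFormula 𝔽 X} (h : K ∈ subs G) : K ∈ subs (.add F G) := by
  simp only [subs, List.mem_cons, List.mem_append]
  exact Or.inr (Or.inr h)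

/-- Subformulas of the left factor are subformulas. [folklore] -/
theorem mem_subs_mul_left {F G K : PIFormula 𝔽 X} (h : K ∈ subs F) : K ∈ subs (.mul F G) := by
  simp only [subs, List.mem_cons, List.mem_append]
  exact Or.inr (Or.inl h)

/-- Subformulas of the right factor are subformulas. [folklore] -/
theorem mem_subs_mul_right {F G K : PIFormula 𝔽 X} (h : K ∈ subs G) : K ∈ subs (.mul F G) := by
  simp only [subs, List.mem_cons, List.mem_append]
  exact Or.inr (Or.inr h)

section Subs

variable [Zero 𝔽] [One 𝔽] [NeZero (1 : 𝔽)]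

/-- **Subformula control**: every subformula of `unorm F` is the normal form of a subformula of `F`
(when `0 ≠ 1`). [folklore] -/
theorem subs_unorm_subset (F : PIFormula 𝔽 X) :
    ∀ J ∈ subs (unorm F), ∃ K ∈ subs F, unorm K = J := by
  induction F with
  | var x =>
    intro J hJ
    simp [subs] at hJ
    exact ⟨.var x, mem_subs_self _, by rw [hJ, unorm_var]⟩
  | const c =>
    intro J hJ
    simp [subs] at hJ
    exact ⟨.const c, mem_subs_self _, by rw [hJ, unorm_const]⟩
  | add F G ihF ihG =>
    intro J hJ
    rw [unorm_add] at hJ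
    by_cases hF : unorm F = .const 0
    · rw [hF, uadd_zero_left] at hJ
      obtain ⟨K, hK, rfl⟩ := ihG J hJ
      exact ⟨K, mem_subs_add_right hK, rfl⟩
    by_cases hG : unorm G = .const 0
    · rw [hG, uadd_zero_right] at hJ
      obtain ⟨K, hK, rfl⟩ := ihF J hJ
      exact ⟨K, mem_subs_add_left hK, rfl⟩
    rw [uadd_of_ne hF hG] at hJ
    simp only [subs, List.mem_cons, List.mem_append] at hJ
    rcases hJ with rfl | hJ | hJ
    · exact ⟨.add F G, mem_subs_self _, by rw [unorm_add, uadd_of_ne hF hG]⟩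
    · obtain ⟨K, hK, rfl⟩ := ihF J hJ
      exact ⟨K, mem_subs_add_left hK, rfl⟩
    · obtain ⟨K, hK, rfl⟩ := ihG J hJ
      exact ⟨K, mem_subs_add_right hK, rfl⟩
  | mul F G ihF ihG =>
    intro J hJ
    rw [unorm_mul] at hJ
    by_cases h0 : unorm F = .const 0 ∨ unorm G = .const 0
    · rw [umul_eq_zero_of h0] at hJ
      simp [subs] at hJ
      subst hJ
      rcases h0 with h | h
      · exact ⟨F, mem_subs_mul_left (mem_subs_self F), h⟩
      · exact ⟨G, mem_subs_mul_right (mem_subs_self G), h⟩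
    have hF0 : unorm F ≠ .const 0 := fun h => h0 (Or.inl h)
    have hG0 : unorm G ≠ .const 0 := fun h => h0 (Or.inr h)
    by_cases hF1 : unorm F = .const 1
    · rw [hF1, umul_one_left hG0] at hJ
      obtain ⟨K, hK, rfl⟩ := ihG J hJ
      exact ⟨K, mem_subs_mul_right hK, rfl⟩
    by_cases hG1 : unorm G = .const 1
    · rw [hG1, umul_one_right hF0] at hJ
      obtain ⟨K, hK, rfl⟩ := ihF J hJ
      exact ⟨K, mem_subs_mul_left hK, rfl⟩
    rw [umul_of_ne hF0 hG0 hF1 hG1] at hJ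
    simp only [subs, List.mem_cons, List.mem_append] at hJ
    rcases hJ with rfl | hJ | hJ
    · exact ⟨.mul F G, mem_subs_self _, by rw [unorm_mul, umul_of_ne hF0 hG0 hF1 hG1]⟩
    · obtain ⟨K, hK, rfl⟩ := ihF J hJ
      exact ⟨K, mem_subs_mul_left hK, rfl⟩
    · obtain ⟨K, hK, rfl⟩ := ihG J hJ
      exact ⟨K, mem_subs_mul_right hK, rfl⟩

end Subs

/-! ### Semantics -/

section Eval

variable [CommSemiring 𝔽]

/-- The smart sum computes the sum. [folklore] -/
theorem eval_uadd (a b : PIFormula 𝔽 X) : (uadd a b).eval = a.eval + b.eval := by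
  unfold uadd
  split_ifs with h1 h2
  · subst h1; simp
  · subst h2; simp
  · simp

/-- The smart product computes the product. [folklore] -/
theorem eval_umul (a b : PIFormula 𝔽 X) : (umul a b).eval = a.eval * b.eval := by
  unfold umul
  split_ifs with h1 h2 h3
  · rcases h1 with rfl | rfl <;> simp
  · subst h2; simp
  · subst h3; simp
  · simp

/-- **Normalising preserves the computed polynomial.** [folklore] -/
theorem eval_unorm (F : PIFormula 𝔽 X) : (unorm F).eval = F.eval := by
  induction F with
  | var x => rfl
  | const c => rfl
  | add F G ihF ihG => rw [unorm_add, eval_uadd, ihF, ihG, PIFormula.eval_add]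
  | mul F G ihF ihG => rw [unorm_mul, eval_umul, ihF, ihG, PIFormula.eval_mul]

end Eval

/-! ### The unit-normal class of a circuit -/

section Circuit

variable [Zero 𝔽] [One 𝔽]

/-- The AC-class of the unit normal form of the unfolding of a Hrubeš–Tzameret circuit. [folklore] -/
def unitClass (C : PICircuit 𝔽 X) : ACClass 𝔽 X := ACClass.mk (unorm C.unfold)

/-- Translating the unit-normal class is renaming the circuit (`unorm` commutes with renaming).
[folklore] -/
theorem smul_unitClass {Γ : Type*} [Group Γ] [MulAction Γ X] (γ : Γ) (C : PICircuit 𝔽 X) :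
    γ • unitClass C = unitClass (C.rename fun x => γ • x) := by
  simp only [unitClass, smul_mk, PICircuit.unfold_rename, unorm_rename]

/-- **ACU-equivalent renamed unfoldings fix the unit-normal class.** [folklore] -/
theorem unitClass_smul_eq_of_uEq [NeZero (1 : 𝔽)] {Γ : Type*} [Group Γ] [MulAction Γ X] {γ : Γ}
    {C : PICircuit 𝔽 X} (h : UEq (C.rename fun x => γ • x).unfold C.unfold) :
    γ • unitClass C = unitClass C := by
  rw [smul_unitClass]
  exact mk_eq_mk.2 (acEq_unorm_of_uEq h)

/-- **Gate budget**: at most `|C| + 1` classes are reachable from the unit-normal class (every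
subformula of `unorm C•` is the normal form of one of the `≤ |C| + 1` distinct subformulas of `C•`).
[folklore] -/
theorem card_reach_unitClass_le [NeZero (1 : 𝔽)] (C : PICircuit 𝔽 X) :
    (reach (unitClass C)).card ≤ C.size + 1 := by
  have h1 : (subs (unorm C.unfold)).toFinset ⊆ (subs C.unfold).toFinset.image unorm := by
    intro J hJ
    obtain ⟨K, hK, rfl⟩ := subs_unorm_subset C.unfold J (List.mem_toFinset.1 hJ)
    exact Finset.mem_image.2 ⟨K, List.mem_toFinset.2 hK, rfl⟩
  calc (reach (unitClass C)).card ≤ ((subs (unorm C.unfold)).toFinset.image mk).card :=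
        Finset.card_le_card (reach_mk_subset _)
    _ ≤ (subs (unorm C.unfold)).toFinset.card := Finset.card_image_le
    _ ≤ ((subs C.unfold).toFinset.image unorm).card := Finset.card_le_card h1
    _ ≤ (subs C.unfold).toFinset.card := Finset.card_image_le
    _ ≤ C.size + 1 := card_subs_unfold_le C

/-- **Multiplicity bound**: a class reachable from the unit-normal class has `< 2 ^ (|C| + 1)`
children (with multiplicity). [folklore] -/
theorem card_kids_lt_of_mem_reach_unitClass {C : PICircuit 𝔽 X} {q : ACClass 𝔽 X}
    (hq : q ∈ reach (unitClass C)) : Multiset.card q.kids < 2 ^ (C.size + 1) := by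
  obtain ⟨K, hK, rfl⟩ := exists_mem_subs_of_reaches (mem_reach.1 hq)
  calc Multiset.card (mk K).kids = (ACStability.kids K).length := by simp
    _ < K.size := length_kids_lt_size K
    _ ≤ (unorm C.unfold).size := size_le_of_mem_subs hK
    _ ≤ C.unfold.size := size_unorm_le _
    _ < 2 ^ (C.size + 1) := size_unfold_lt C

end Circuit

/-! ### The symmetric circuit -/

section Main

variable [CommSemiring 𝔽]

/-- The unit-normal class computes `Ĉ`. [folklore] -/
theorem eval_unitClass (C : PICircuit 𝔽 X) : (unitClass C).eval = C.eval := by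
  simp only [unitClass, eval_mk, eval_unorm]
  rfl

/-- **Rung S3‴, generic core.** If the renamed unfoldings `(C ∘ γ)•`, `γ ∈ Γ`, are ACU-equivalent to
`C•` (constants with `0 ≠ 1`), the AC-canonical circuit of `unitClass C` with chain length `|C| + 1`
is a `Γ`-symmetric labelled arithmetic circuit computing `Ĉ` with at most
`2(|C|+1) + 2(|C|+1)³` gates. [folklore] -/
theorem exists_isSymmetric_of_uEq [Nontrivial 𝔽] {Γ : Type*} [Group Γ] [MulAction Γ X]
    (C : PICircuit 𝔽 X) (h : ∀ γ : Γ, UEq (C.rename fun x => γ • x).unfold C.unfold) :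
    ∃ (G : Type (max u v)) (_ : Fintype G) (D : LabelledArithCircuit 𝔽 X Unit G),
      D.IsSymmetric Γ ∧ D.eval (D.output ()) = C.eval ∧
      Fintype.card G ≤ 2 * (C.size + 1) + 2 * (C.size + 1) * (C.size + 1) ^ 2 := by
  have hL : ∀ q ∈ reach (unitClass C), Multiset.card q.kids < 2 ^ (C.size + 1) :=
    fun _ hq => card_kids_lt_of_mem_reach_unitClass hq
  have ht : ∀ γ : Γ, γ • unitClass C = unitClass C := fun γ => unitClass_smul_eq_of_uEq (h γ)
  exact ⟨ACGate (unitClass C) (C.size + 1), inferInstance, acCircuit (unitClass C) (C.size + 1) hL,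
    isSymmetric_acCircuit hL ht, (eval_output_acCircuit hL).trans (eval_unitClass C),
    card_acGate_le (C.size + 1) (card_reach_unitClass_le C)⟩

/-- The gate count is `≤ (|C| + n + 2)^4`. [folklore] -/
theorem gate_bound (s n : ℕ) : 2 * (s + 1) + 2 * (s + 1) * (s + 1) ^ 2 ≤ (s + n + 2) ^ 4 := by
  set a : ℕ := s + 1 with ha
  have h1 : 2 * a + 2 * a * a ^ 2 ≤ (a + 1) ^ 4 := by nlinarith
  calc 2 * a + 2 * a * a ^ 2 ≤ (a + 1) ^ 4 := h1
    _ ≤ (s + n + 2) ^ 4 := Nat.pow_le_pow_left (by omega) 4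

/-- Polynomial bookkeeping for the weakened bet: `((m ^ c₂) + n + 2) ^ c₃ ≤ m ^ ((c₂ + 2) c₃)` for
`m = s + t + n + 2`, `1 ≤ s` (as `poly_absorb` in the line's skeleton). [folklore] -/
theorem poly_absorb' (c₂ c₃ s t n : ℕ) (hs : 1 ≤ s) :
    ((s + t + n + 2) ^ c₂ + n + 2) ^ c₃ ≤ (s + t + n + 2) ^ ((c₂ + 2) * c₃) := by
  set m : ℕ := s + t + n + 2 with hm
  have hm2 : 2 ≤ m := by omega
  have h1 : m ^ c₂ + n + 2 ≤ m ^ (c₂ + 2) := by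
    have hA : 1 ≤ m ^ c₂ := Nat.one_le_pow _ _ (by omega)
    have hB : n + 2 ≤ m := by omega
    calc m ^ c₂ + n + 2 ≤ m ^ c₂ + m := by omega
      _ ≤ m ^ c₂ * m + m ^ c₂ * m := by nlinarith
      _ = 2 * m ^ (c₂ + 1) := by ring
      _ ≤ m * m ^ (c₂ + 1) := Nat.mul_le_mul_right _ hm2
      _ = m ^ (c₂ + 2) := by ring
  calc (m ^ c₂ + n + 2) ^ c₃ ≤ (m ^ (c₂ + 2)) ^ c₃ := Nat.pow_le_pow_left h1 _
    _ = m ^ ((c₂ + 2) * c₃) := by rw [← pow_mul]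

end Main

end ACStability

open Literature.Computability.AlgebraicComplexity

/-- **Rung S3‴ — stability when invariance proofs avoid only A6 and A10** (helper under the
registered stub S2″ `stub_proofsToACEquiv` of the line `registered` of crux `RestorationQP`, item
stmt-ValiantsHypothesis-10343): if for every `σ ∈ S_n` the unfoldings `(C ∘ σ)•` and `C•` of a
Hrubeš–Tzameret circuit `C` over `ℂ` in the matrix variables are inter-derivable in `P_f(ℂ)` using
A1–A5, the unit laws A7–A9 and the rules (no distributivity A6, no constant equations A10), then the
AC-canonical circuit of the unit-normal class of `C` is an `S_n`-symmetric labelled arithmetic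
circuit (Dawar–Wilsenach Def. 3.7) computing `Ĉ`, of size `≤ (|C| + n + 2)^4`. [folklore] -/
theorem stabilityAtUnitEquiv : ∃ c : ℕ, ∀ (n : ℕ) (C : PICircuit ℂ (Fin n × Fin n)), (∀ σ : Equiv.Perm (Fin n), (pfSystem ℂ (Fin n × Fin n)).Provable (C.rename fun x : Fin n × Fin n => σ • x).unfold C.unfold ⊤ (fun s => if s = PIAxiom.A6 ∨ s = PIAxiom.A10 then 0 else ⊤)) → ∃ (G : Type) (_ : Fintype G) (D : LabelledArithCircuit ℂ (Fin n × Fin n) Unit G), D.IsSymmetric (Equiv.Perm (Fin n)) ∧ D.eval (D.output ()) = C.eval ∧ Fintype.card G ≤ (C.size + n + 2) ^ c := by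
  refine ⟨4, fun n C h => ?_⟩
  obtain ⟨G, hG, D, hsym, hev, hcard⟩ :=
    ACStability.exists_isSymmetric_of_uEq (Γ := Equiv.Perm (Fin n)) C
      fun σ => ACStability.uEq_of_pfProvable (fun s hs => if_pos hs) (h σ)
  exact ⟨G, hG, D, hsym, hev, hcard.trans (ACStability.gate_bound C.size n)⟩

/-- **Rung S3‴ from `P_c` proofs**: if every invariance identity `C ∘ σ = C`, `σ ∈ S_n`, has a
`P_c(ℂ)`-proof using no instance of A6 (distributivity) or A10 (constant equations) — A1–A5, the unit
laws A7–A9, C1, C2 and the rules allowed — then an `S_n`-symmetric labelled arithmetic circuit of size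
`≤ (|C| + n + 2)^4` computes `Ĉ`. [folklore] -/
theorem stabilityAtUnitBudget : ∃ c : ℕ, ∀ (n : ℕ) (C : PICircuit ℂ (Fin n × Fin n)), (∀ σ : Equiv.Perm (Fin n), HasPCProof (C.rename fun x : Fin n × Fin n => σ • x) C (fun s => if s = PIAxiom.A6 ∨ s = PIAxiom.A10 then 0 else ⊤)) → ∃ (G : Type) (_ : Fintype G) (D : LabelledArithCircuit ℂ (Fin n × Fin n) Unit G), D.IsSymmetric (Equiv.Perm (Fin n)) ∧ D.eval (D.output ()) = C.eval ∧ Fintype.card G ≤ (C.size + n + 2) ^ c := by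
  refine ⟨4, fun n C h => ?_⟩
  obtain ⟨G, hG, D, hsym, hev, hcard⟩ :=
    ACStability.exists_isSymmetric_of_uEq (Γ := Equiv.Perm (Fin n)) C
      fun σ => ACStability.uEq_unfold_of_hasPCProof (fun s hs => if_pos hs) (h σ)
  exact ⟨G, hG, D, hsym, hev, hcard.trans (ACStability.gate_bound C.size n)⟩

/-- **The weakened bet S2‴ implies the registered bet S2″.** If size-`t` proofs of all invariance
identities of `C` yield a circuit `C₁` for `Ĉ` of size `≤ (|C|+t+n+2)^c` whose renamed unfoldings are
inter-derivable with `C₁•` in `P_f(ℂ)` without A6 and A10 (unit laws allowed), then they also yield a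
circuit `C'` for `Ĉ` of size `≤ (|C|+t+n+2)^(3(c+2)·4+1)` whose renamed unfoldings are inter-derivable
with `C'•` without A6–A10: `stabilityAtUnitEquiv` makes `C₁` an `S_n`-symmetric labelled circuit,
which lays out (`ACStability.exists_piCircuit_of_isSymmetric`) as a straight-line circuit whose
renamed unfoldings are AC-equivalent to its unfolding (`ACStability.pfProvable_of_acEq`). [folklore] -/
theorem proofsToACEquiv_of_proofsToUnitEquiv : (∃ c : ℕ, ∀ (n t : ℕ) (C : PICircuit ℂ (Fin n × Fin n)), (∀ σ : Equiv.Perm (Fin n), HasPCProofOfSize (C.rename fun x : Fin n × Fin n => σ • x) C t) → ∃ C' : PICircuit ℂ (Fin n × Fin n), C'.eval = C.eval ∧ C'.size ≤ (C.size + t + n + 2) ^ c ∧ ∀ σ : Equiv.Perm (Fin n), (pfSystem ℂ (Fin n × Fin n)).Provable (C'.rename fun x : Fin n × Fin n => σ • x).unfold C'.unfold ⊤ (fun s => if s = PIAxiom.A6 ∨ s = PIAxiom.A10 then 0 else ⊤)) → (∃ c : ℕ, ∀ (n t : ℕ) (C : PICircuit ℂ (Fin n × Fin n)), (∀ σ :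 Equiv.Perm (Fin n), HasPCProofOfSize (C.rename fun x : Fin n × Fin n => σ • x) C t) → ∃ C' : PICircuit ℂ (Fin n × Fin n), C'.eval = C.eval ∧ C'.size ≤ (C.size + t + n + 2) ^ c ∧ ∀ σ : Equiv.Perm (Fin n), (pfSystem ℂ (Fin n × Fin n)).Provable (C'.rename fun x : Fin n × Fin n => σ • x).unfold C'.unfold ⊤ (fun s => if s = PIAxiom.A6 ∨ s = PIAxiom.A7 ∨ s = PIAxiom.A8 ∨ s = PIAxiom.A9 ∨ s = PIAxiom.A10 then 0 else ⊤)) := by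
  rintro ⟨c, hc⟩
  obtain ⟨c₃, h₃⟩ := stabilityAtUnitEquiv
  refine ⟨3 * ((c + 2) * c₃) + 1, fun n t C hC => ?_⟩
  obtain ⟨C₁, hC₁ev, hC₁size, hC₁pf⟩ := hc n t C hC
  obtain ⟨G, hG, D, hsym, hev, hcard⟩ := h₃ n C₁ hC₁pf
  obtain ⟨C', -, hC'ev, hC'size, hC'ac⟩ :=
    ACStability.exists_piCircuit_of_isSymmetric (Γ := Equiv.Perm (Fin n)) D hsym () (fun _ => rfl)
  refine ⟨C', hC'ev.trans (hev.trans hC₁ev), ?_, fun σ => ACStability.pfProvable_of_acEq (hC'ac σ)⟩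
  refine hC'size.trans ?_
  set m : ℕ := C.size + t + n + 2 with hm
  set K : ℕ := (c + 2) * c₃ with hK
  have hm3 : 3 ≤ m := by have := C.one_le_size; omega
  have hG' : Fintype.card G ≤ m ^ K :=
    calc Fintype.card G ≤ (C₁.size + n + 2) ^ c₃ := hcard
      _ ≤ (m ^ c + n + 2) ^ c₃ := Nat.pow_le_pow_left (by omega) _
      _ ≤ m ^ K := ACStability.poly_absorb' c c₃ C.size t n C.one_le_size
  calc Fintype.card G * Fintype.card G * (Fintype.card G + 2)
      ≤ m ^ K * m ^ K * (m ^ K + 2) :=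
        Nat.mul_le_mul (Nat.mul_le_mul hG' hG') (Nat.add_le_add_right hG' 2)
    _ ≤ m ^ (3 * K + 1) := ACStability.pow_cube_bound m K hm3

end Summit.ValiantsHypothesis.ValiantsHypothesis.Theorems

end
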